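import Literature.Barriers.ValiantsHypothesis.GCTMatrixPoweringProp20Holds
import Literature.Barriers.ValiantsHypothesis.GCTMatrixPoweringCor9
import HarnessLib

/-!
# Barrier `GCTMatrixPowering`: the exact reach of the no-go (D-0021 barrier audit, 2026-08-16)

The catalogue entry `Literature.Barriers.ValiantsHypothesis.GCTMatrixPowering` vendors the Main
Result, Thm. 10, of Gesmundo–Ikenmeyer–Panova, *Geometric complexity theory and matrix powering*
(arXiv:1611.00827 = Diff. Geom. Appl. 55 (2017); held, re-read for this audit, flat page numbers
of the held text): in the homogeneous (padding-free) setting `per_m` versus `Pow^m_n = tr(X^m)`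
under `GL_{n²}` there is no ORBIT occurrence obstruction — no `λ ⊢ dm` with `q_λ(d[m]) > 0`
(occurrence in `ℂ[\overline{GL_{n²} per_m}]_d`) and `sm(λ, n) = 0` (the multiplicity of `V_λ` in
the coordinate ring of the ORBIT `GL_{n²} Pow^m_n`, Thm. 8) — once `m ≥ 10` and `n ≥ m + 2`
(p. 7: Cor. 9 "We call these `λ` orbit occurrence obstructions", Thm. 10, "no superlinear lower
bounds can be proved with orbit occurrence obstructions"). Tree letters swap GIP's `m, n`
(PERMANENT size `n`, MATRIX size `m`), as in the barrier file.

**Audit verdict: CONFIRMED, and the reach is WIDER than the entry's `blocks:` line.** The fact is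
exactly Thm. 10 and is a theorem of the tree resting on no named fact (`GCTMatrixPowering_holds`,
`GCTMatrixPoweringProp20Holds.lean`), as are the obstruction principle Cor. 9
(`GIP2017_cor9_holds`) and Grenet's `pc(per_n) ≤ 2^n - 1` (`GCTMatrixPoweringGrenet.lean`); the
two errata found while vendoring the printed proof (Prop. 18 omits `(2,1³)`, `not_GIP2017_prop18`;
the row bound of Prop. 19 fails at `a = s² - 2`, `GIP2017_prop19_false`) do not touch Thm. 10,
whose shapes have `λ₁ ≥ 3`. Nothing to refute or narrow; this file records, WITH PROOFS, how far
the no-go actually reaches, so that planners do not look for the gap where there is none.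

**(i) The technique class is covered for EVERY target, not only the permanent** (§§2, 4). GIP's
proof uses of `per_m` only its degree and its number of variables: Lemma 12 (`q_λ ≤ a_λ`,
`ℓ(λ) ≤ #variables`, p. 7), Prop. 13 (`a_λ(d[m]) = 0` if `λ₁ < m`), Prop. 20 with `L = m²`; their
remark "the arguments in this paper remain valid if the permanent is replaced by any other
VNP-complete function, mutatis mutandis" (§2, p. 4) is made a theorem here: for ANY form `h` of degree `n ≥ 3` on `V = ℂ^{m²}`
with variables in a set `A`, every `λ ⊢ d·n` (at most `m²` parts) occurring in
`ℂ[\overline{GL_{m²} h}]_d` has `sm(λ, m) > 0` as soon as `m ≥ ℓ(|A|) = max{⌈√|A|⌉ + 2, 12}`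
(`smPos_of_hasHighestWeight_orbitCoordRep`); equivalently an orbit occurrence obstruction against
`h` sits at a matrix size `m < ℓ(|A|)`, i.e. `m ≤ 11` or `|A| > (m - 2)²`
(`lt_gipEll_of_not_smPos`, `le_eleven_or_sq_lt_card_of_not_smPos`). On the other side Prop. 5,
Cor. 6 / Thm. 8 and Cor. 9 hold for any target verbatim (`mem_orbitClosure_powFormLex_of_hasPowTraceRepr`,
`smPos_of_hasPowTraceRepr`, `lt_powTraceComplexity_of_not_smPos`): an obstruction at size `m`
certifies `pc(h) > m`. Together (`orbitOccurrenceObstruction_reach`): whatever the target, orbit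
occurrence obstructions in the matrix-powering model certify at most
`pc(h) ≥ max{⌈√|A|⌉ + 2, 12}` — within `2` of counting variables (a power-trace representation of
size `m` writes `h` in the `m²` linear forms `A_{ij}`, so `m² ≥ #essential variables of h`; this
last remark is prose, not vendored). Changing the VNP-complete (or any other) target family is
therefore NOT an evasion.

**(ii) The thresholds are cosmetic** (§3). `m ≥ 10` [GIP's letter] only serves to write
`max{m + 2, 12}` as `m + 2`: for every permanent size `n ≥ 3` and matrix size `m ≥ max{n + 2, 12}`
there is no orbit occurrence obstruction (`smPos_of_hasHighestWeight_blockPerOrbitRep`,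
`not_isOrbitOccurrenceObstruction_of_max_le`), so the certified bound is at most
`pc(per_n) > max{n + 1, 11}` (`IsOrbitOccurrenceObstruction.lt_max`, with the proved Cor. 9); the
barrier fact (`10 ≤ n`, `n + 2 ≤ m`, landed as `GCTMatrixPowering_holds`) is the case
`max{n + 2, 12} = n + 2`. Degrees `n ≤ 2` (linear and quadratic forms) are outside: there the
excluded families `(2,2,1^k)`, `(2,1^k)` of Prop. 20 have `λ₁ = n`, and nothing is claimed.

**(iii) What the barrier does NOT cover** (the live lines; page-level sources):
* occurrence obstructions with respect to the orbit CLOSURE of `Pow^m_n` — `t_{λ,n}(d[m]) = 0 <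
  q_λ(d[m])` with `sm(λ, n) > 0` — are untouched: only `t ≤ sm` and `sm > 0` are shown (Thm. 8,
  Thm. 10); "BIP lifts the result of [IP17] to the closure, which appears to be challenging in the
  homogeneous setting because of the absence of the padding" (p. 7); `Pow^m_n` "is not
  characterized by its stabilizer" (Rem. 11 p. 7, Prop. 31 p. 18), so the orbit ring is a coarse
  upper bound; Bürgisser's 2024 survey: "It is shown that with orbit occurrence obstructions, not even
  superlinear lower bounds can be shown! While this makes it unlikely that occurrence obstructions
  could do the job, this is not excluded by this paper" (§7.5, held text p. 31). Formal statement: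
  the open `Literature.Barriers.PneNP.PowOccurrenceObstructionConjecture`.
* multiplicity obstructions `q_λ(d[m]) > t_{λ,n}(d[m])` (Cor. 6, p. 6), including the COMPUTABLE
  intermediate class `q_λ(d[m]) > sm(λ, n)` ("orbit multiplicity obstructions": `sm` is a sum of
  symmetric Kronecker coefficients, Thm. 8) — Thm. 10 gives `sm ≥ 1` and no more; in a toy model
  multiplicity obstructions separate where occurrence obstructions provably cannot
  [Dörfler–Ikenmeyer–Panova 2020, abstract].
* other homogeneous models: iterated matrix multiplication `IMM` ("even more challenging",
  Rem. 11; "It is unknown whether the method of occurrence obstructions can achieve this",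
  Bürgisser 2024 §7.5 p. 31; "There are no no-go results known for this approach, but no strong
  equations vanishing on the orbit closure of IMM have been found so far", Dutta–Gesmundo–
  Ikenmeyer–Jindal–Lysikov ITCS 2024, §1, held text p. 3); and the `VF`-complete (under
  homogeneous border qp-projections) parity-alternating elementary symmetric polynomial `C_{n,d}`
  of Dutta et al. (JSC 2026), "a homogeneous, padding-free formulation", where a toy OCCURRENCE
  obstruction is reported — `(5,5,5,3,3)` in the vanishing ideal of `\overline{GL_5 C_{5,3}}`,
  plethysm coefficient `a_{(5,5,5,3,3)}(7[3]) = 1`, by randomised evaluation of the highest weight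
  vector, "it remains to be symbolically verified" (Thm. 5 and the paragraph after it, held text
  p. 7).
* occurrence obstructions (even orbit ones) do prove bounds in other orbit-closure problems —
  border rank of matrix multiplication `≥ 3/2 m² - 2` (Bürgisser 2024 §7.5 p. 31).

No refutation and no narrowing, hence no idea-card seed is mandated by this audit; the
planner-facing summary is: the gap in `GCTMatrixPowering` is (closure versus orbit) or
(multiplicity versus occurrence) or (a model other than `tr(X^m)`), never the choice of target
polynomial and never the degree.

## Sources

* [GesmundoIkenmeyerPanova2017] abstract; §2 (p. 4: "mutatis mutandis"); §2.1 (pp. 5–6: `sk`,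
  orbit occurrence obstructions in the padded setting); §2.2 (p. 6: `pc`, Prop. 5, Cor. 6; p. 7:
  Thm. 7, Thm. 8, Cor. 9, Thm. 10, Rem. 11, Lemma 12, Props. 13–14); §3 (Prop. 20); §5 (Prop. 31,
  p. 18) — held (`paper:arxiv-1611.00827`, flat page numbers of the held text).
* [Burgisser2024Completeness] §7.5 (held text p. 31).
* [DuttaGesmundoIkenmeyerJindalLysikov2024] §1 (held text p. 3).
* [DuttaEtAl2026] abstract, Thm. 4, Thm. 5 and the `C_{5,3}` computation (held text pp. 2, 7).
* [DorflerIkenmeyerPanova2020] abstract.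
* [BurgisserIkenmeyerPanovaJAMS2019] Thm. 4.9(1) (the length bound, tree
  `apply_eq_zero_of_hasHighestWeight_orbitCoordRep_of_vars_subset`); [BurgisserEtAl2011] §5.2
  (the lift, tree `hasHighestWeight_coordRep_of_orbitCoordRep_holds`).
-/

noncomputable section

namespace Literature.Barriers.ValiantsHypothesis

open Literature.NumberTheory.DiophantineGeometry Literature.Computability.AlgebraicComplexity
  Literature.Computability.Complexity MvPolynomial

/-! ### 1. Arithmetic of the exceptional list and of the row bound `ℓ(L)` -/

/-- Every corrected exceptional shape of GIP Prop. 20 (the ten shapes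
`(1²), (1³), (1⁴), (1⁷), (1⁸), (1¹²), (2,1²), (2,1³), (3,1²), (2,1⁷)`) has largest part at most `3`.
[cite: GesmundoIkenmeyerPanova2017, Prop. 20 (the exceptional list)] -/
theorem sup_le_three_of_mem_gipExceptionalShapesCorrected {s : Multiset ℕ}
    (h : s ∈ gipExceptionalShapesCorrected) : s.sup ≤ 3 := by
  rcases (mem_gipExceptionalShapesCorrected_iff s).mp h with rfl | h
  · decide
  · rcases (mem_gipExceptionalShapes_iff s).mp h with
      rfl | rfl | rfl | rfl | rfl | rfl | rfl | rfl | rfl <;> decide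

/-- The row bound `ℓ(L) = max{⌈√L⌉ + 2, 12}` of GIP Prop. 20 is monotone in `L`.
[cite: GesmundoIkenmeyerPanova2017, Prop. 20 (ℓ := max{⌈√L⌉+2, 12})] -/
theorem gipEll_mono {L₁ L₂ : ℕ} (h : L₁ ≤ L₂) : gipEll L₁ ≤ gipEll L₂ := by
  unfold gipEll
  have := Nat.sqrt_le_sqrt (Nat.sub_le_sub_right h 1)
  omega

/-- `ℓ(n²) ≤ max{n + 2, 12}` for every `n` (with equality for `n ≥ 1`; the companion file's
`gipEll_sq` is the case `n ≥ 10`, where the maximum is `n + 2`).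
[cite: GesmundoIkenmeyerPanova2017, §3 (proof of Prop. 14, "ℓ = max{m+2, 12}")] -/
theorem gipEll_sq_le (n : ℕ) : gipEll (n ^ 2) ≤ max (n + 2) 12 := by
  unfold gipEll
  rcases Nat.eq_zero_or_pos n with rfl | hn
  · have h0 : Nat.sqrt (0 ^ 2 - 1) = 0 := Nat.sqrt_eq_zero.mpr (by norm_num)
    rw [h0]
    norm_num
  · have h1 : n ^ 2 - 1 < n ^ 2 := Nat.sub_lt (Nat.pow_pos hn) one_pos
    have h2 : Nat.sqrt (n ^ 2 - 1) < n := Nat.sqrt_lt'.mpr h1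
    omega

/-- Unfolding the strict bound `m < ℓ(L)`: either `m ≤ 11`, or `(m - 2)² < L` (so that
`m < √L + 2`). [cite: GesmundoIkenmeyerPanova2017, Prop. 20 (ℓ := max{⌈√L⌉+2, 12})] -/
theorem le_eleven_or_sq_lt_of_lt_gipEll {m L : ℕ} (h : m < gipEll L) :
    m ≤ 11 ∨ (m - 2) ^ 2 < L := by
  rcases le_or_gt (gipEll L) 12 with h12 | h12
  · left
    omega
  · right
    have hlt := gipEll_sub_three_sq_lt h12
    have hle : m - 2 ≤ gipEll L - 3 := by omega
    exact lt_of_le_of_lt (Nat.pow_le_pow_left hle 2) hlt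

/-! ### 2. GIP Thm. 10 for an ARBITRARY target form (the permanent is not used) -/

/-- **GIP Thm. 10, target-universal form (proved).** Let `h` be ANY form of degree `n ≥ 3` on the
matrix space `V = ℂ^{m²}` (lexicographic variables `MatIdx m`) whose variables lie in a set `A`,
and let the matrix size satisfy `m ≥ ℓ(|A|) = max{⌈√|A|⌉ + 2, 12}`. Then every `λ ⊢ d·n` with
at most `m²` parts occurring in `ℂ[\overline{GL_{m²} · h}]_d` has `sm(λ, m) > 0` — i.e. there is
no orbit occurrence obstruction against `h ∈ \overline{GL_{m²} · Pow^n_m}` at matrix size `m`.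
GIP's printed proof of Thm. 10 uses of `per_m` only its degree and its number of variables
(Lemma 12: `q_λ ≤ a_λ`, `ℓ(λ) ≤ #vars`; Prop. 13: `λ₁ ≥ deg`; Prop. 20 with `L = #vars`), cf.
"the arguments in this paper remain valid if the permanent is replaced by any other VNP-complete
function, mutatis mutandis" (§2, p. 4); here this is run for an arbitrary `h`: the BLMW lift
(`hasHighestWeight_coordRep_of_orbitCoordRep_holds`), BIP Thm. 4.9(1) in weight form
(`apply_eq_zero_of_hasHighestWeight_orbitCoordRep_of_vars_subset`), Prop. 13 (`GIP2017_prop13`)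
and the corrected, proved Prop. 20 (`GIP2017_prop20_corrected_holds`), whose ten exceptional
shapes and the family `(2,2,1^k)` all have `λ₁ ≤ 3` and are excluded by `λ₁ ≥ n ≥ 3` (the shape
`(3,1,1) ⊢ 5` would need `n = 3 ∣ 5`); `d = 0` is `sm(∅, m) = 1` (`smPos_of_eq_zero`).
[cite: GesmundoIkenmeyerPanova2017, Thm. 10 (proof, p. 7: Lemma 12, Prop. 13, Prop. 14) and Prop. 20] -/
theorem smPos_of_hasHighestWeight_orbitCoordRep {n m d : ℕ} (hn : 3 ≤ n)
    {h : MvPolynomial (MatIdx m) ℂ} (hh : h.IsHomogeneous n) {A : Finset (MatIdx m)}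
    (hA : ↑h.vars ⊆ (A : Set (MatIdx m))) (hm : gipEll A.card ≤ m)
    (lam : Nat.Partition (d * n)) (hlam : lam.parts.card ≤ m * m)
    (hocc : HasHighestWeight (orbitCoordRep h n) (partitionWeightLex m lam)) : SmPos m lam := by
  classical
  rcases Nat.eq_zero_or_pos d with rfl | hd
  · exact smPos_of_eq_zero (Nat.zero_mul n) m lam
  -- Lemma 12, first part: `λ` occurs in `ℂ[Sym^n V^*]`
  have hcoord : HasHighestWeight (coordRep (MatIdx m) ℂ n) (partitionWeightLex m lam) :=
    hasHighestWeight_coordRep_of_orbitCoordRep_holds _ (by omega) hh hocc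
  -- Prop. 13: `λ₁ ≥ n`
  have hsup : n ≤ lam.parts.sup := GIP2017_prop13 lam hlam hd hcoord
  -- Lemma 12, second part: `ℓ(λ) ≤ |A|`
  have hlen : lam.parts.card ≤ A.card := by
    apply card_parts_le_of_dualOfPartition_apply_eq_zero lam hlam
    intro i hi
    have h0 := apply_eq_zero_of_hasHighestWeight_orbitCoordRep_of_vars_subset (matIdxEquiv m) _ _
      hA hocc i hi
    simpa only [partitionWeightLex, Weight.toMatIdx, OrderIso.symm_apply_apply] using h0
  -- the exceptional shapes are excluded by `λ₁ ≥ n ≥ 3`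
  have hsum : lam.parts.sum = d * n := lam.parts_sum
  have hexc : lam.parts ∉ gipExceptionalShapesCorrected := by
    intro hmem
    have h3 := sup_le_three_of_mem_gipExceptionalShapesCorrected hmem
    rcases sup_le_two_or_sum_eq_five_of_mem_gipExceptionalShapesCorrected hmem with h2 | h5
    · omega
    · obtain rfl : n = 3 := by omega
      omega
  have h22 : ∀ k : ℕ, lam.parts ≠ 2 ::ₘ 2 ::ₘ Multiset.replicate k 1 := by
    intro k hk
    have hle : (2 ::ₘ 2 ::ₘ Multiset.replicate k 1).sup ≤ 2 := by
      rw [Multiset.sup_cons, Multiset.sup_cons]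
      refine max_le le_rfl (max_le le_rfl (Multiset.sup_le.mpr fun b hb => ?_))
      rw [Multiset.eq_of_mem_replicate hb]
      exact one_le_two
    rw [← hk] at hle
    omega
  -- Prop. 20 (corrected, proved) with `L = |A|`, and monotonicity in the number of rows
  exact (GIP2017_prop20_corrected_holds (d * n) A.card lam hlen hexc h22).mono hm

/-- **The no-go, target-universal reading.** An orbit occurrence obstruction against an arbitrary
target form `h` of degree `n ≥ 3` with variables in `A` — a `λ ⊢ d·n` with at most `m²` parts
occurring in `ℂ[\overline{GL_{m²} · h}]_d` with `sm(λ, m) = 0` — can only sit at a matrix size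
`m < ℓ(|A|) = max{⌈√|A|⌉ + 2, 12}`. [cite: GesmundoIkenmeyerPanova2017, Thm. 10 and Prop. 20] -/
theorem lt_gipEll_of_not_smPos {n m d : ℕ} (hn : 3 ≤ n)
    {h : MvPolynomial (MatIdx m) ℂ} (hh : h.IsHomogeneous n) {A : Finset (MatIdx m)}
    (hA : ↑h.vars ⊆ (A : Set (MatIdx m)))
    (lam : Nat.Partition (d * n)) (hlam : lam.parts.card ≤ m * m)
    (hocc : HasHighestWeight (orbitCoordRep h n) (partitionWeightLex m lam))
    (hsm : ¬ SmPos m lam) : m < gipEll A.card := by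
  by_contra hge
  exact hsm (smPos_of_hasHighestWeight_orbitCoordRep hn hh hA (not_lt.mp hge) lam hlam hocc)

/-- **Numeric form**: such an obstruction sits at matrix size `m ≤ 11` or needs a target with more
than `(m - 2)²` variables, `|A| > (m - 2)²` — within `2` of the regime `m ≤ √|A|` where counting
variables is already an obstruction (`m²` linear forms span at most `m²` variables).
[cite: GesmundoIkenmeyerPanova2017, Thm. 10 and Prop. 20] -/
theorem le_eleven_or_sq_lt_card_of_not_smPos {n m d : ℕ} (hn : 3 ≤ n)
    {h : MvPolynomial (MatIdx m) ℂ} (hh : h.IsHomogeneous n) {A : Finset (MatIdx m)}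
    (hA : ↑h.vars ⊆ (A : Set (MatIdx m)))
    (lam : Nat.Partition (d * n)) (hlam : lam.parts.card ≤ m * m)
    (hocc : HasHighestWeight (orbitCoordRep h n) (partitionWeightLex m lam))
    (hsm : ¬ SmPos m lam) : m ≤ 11 ∨ (m - 2) ^ 2 < A.card :=
  le_eleven_or_sq_lt_of_lt_gipEll (lt_gipEll_of_not_smPos hn hh hA lam hlam hocc hsm)

/-! ### 3. The permanent in every degree `n ≥ 3` (the threshold `n ≥ 10` is cosmetic) -/

/-- **GIP Thm. 10 for all permanent sizes `n ≥ 3`**: at matrix size `m ≥ max{n + 2, 12}` every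
`λ ⊢ d·n` with at most `m²` parts occurring in `ℂ[\overline{GL_{m²} per_n}]_d` has `sm(λ, m) > 0`
(the printed hypothesis `m ≥ 10` [GIP's letter for the permanent size] only serves to write
`max{n + 2, 12}` as `n + 2`). The case `h = per_n`, `A` = the `n²` block variables, of
`smPos_of_hasHighestWeight_orbitCoordRep`. [cite: GesmundoIkenmeyerPanova2017, Thm. 10 and Prop. 20 (with L = m²)] -/
theorem smPos_of_hasHighestWeight_blockPerOrbitRep {n m d : ℕ} (hn : 3 ≤ n)
    (hm : max (n + 2) 12 ≤ m) (lam : Nat.Partition (d * n)) (hlam : lam.parts.card ≤ m * m)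
    (hocc : HasHighestWeight (blockPerOrbitRep n m) (partitionWeightLex m lam)) : SmPos m lam := by
  classical
  have hnm : n ≤ m := le_trans (by omega) hm
  change HasHighestWeight (orbitCoordRep (Literature.Barriers.PneNP.blockPerFormLex n m) n)
    (partitionWeightLex m lam) at hocc
  refine smPos_of_hasHighestWeight_orbitCoordRep hn
    (Literature.Barriers.PneNP.blockPerFormLex_isHomogeneous hnm) (vars_blockPerFormLex_subset n m)
    ?_ lam hlam hocc
  calc gipEll _ ≤ gipEll (n ^ 2) := gipEll_mono (card_image_topBlockIdx_le n m hnm)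
    _ ≤ max (n + 2) 12 := gipEll_sq_le n
    _ ≤ m := hm

/-- No orbit occurrence obstruction (the technique class `IsOrbitOccurrenceObstruction` of the
barrier file) exists for `n ≥ 3` and `m ≥ max{n + 2, 12}`.
[cite: GesmundoIkenmeyerPanova2017, Thm. 10] -/
theorem not_isOrbitOccurrenceObstruction_of_max_le {n m d : ℕ} (hn : 3 ≤ n)
    (hm : max (n + 2) 12 ≤ m) (lam : Nat.Partition (d * n)) :
    ¬ IsOrbitOccurrenceObstruction n m lam :=
  fun ⟨hcard, hocc, hsm⟩ => hsm (smPos_of_hasHighestWeight_blockPerOrbitRep hn hm lam hcard hocc)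

/-- **"Not even superlinear", all degrees**: for `n ≥ 3` an orbit occurrence obstruction at matrix
size `m` forces `m ≤ max{n + 1, 11}`; with the proved obstruction principle (Cor. 9,
`GIP2017_cor9_holds`, `m ≥ 3`) the certified bound `m < pc(per_n)` is therefore at most
`pc(per_n) > max{n + 1, 11}`. [cite: GesmundoIkenmeyerPanova2017, abstract, Cor. 9 and Thm. 10] -/
theorem IsOrbitOccurrenceObstruction.lt_max {n m d : ℕ} (hn : 3 ≤ n) (hm : 3 ≤ m)
    (lam : Nat.Partition (d * n)) (hobs : IsOrbitOccurrenceObstruction n m lam) :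
    m < powTraceComplexity ℂ (perPoly (Fin n) ℂ) n ∧ m < max (n + 2) 12 := by
  refine ⟨GIP2017_cor9_holds n m d hn hm lam hobs, ?_⟩
  by_contra hge
  exact not_isOrbitOccurrenceObstruction_of_max_le hn (not_lt.mp hge) lam hobs

-- The barrier fact itself (`GCTMatrixPowering = GIP2017_thm10`: `10 ≤ n`, `n + 2 ≤ m`) is the case
-- `max (n + 2) 12 = n + 2` of `smPos_of_hasHighestWeight_blockPerOrbitRep`; it is already landed as
-- `GCTMatrixPowering_holds` (`GCTMatrixPoweringProp20Holds.lean`) and is not restated here.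

/-! ### 4. The obstruction principle for an arbitrary target (Prop. 5 and Cor. 9, mutatis mutandis) -/

/-- **GIP Prop. 5 for any target.** If a form `h` on `V = ℂ^{m²}` is `tr(A^n)` for an `m × m`
matrix `A` of homogeneous linear forms on `V` (`HasPowTraceRepr ℂ h n m`), then `h` is the linear
substitution of `Pow^n_m = tr(X^n)` by the coefficient matrix of the entries of `A`, hence lies in
`\overline{GL_{m²} · Pow^n_m}` (`GL` is Zariski dense in `End`, `endOrbit_subset_orbitClosure_holds`);
the computation of `exists_linSubst_powFormLex_eq` (there for `per_n`) verbatim.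
[cite: GesmundoIkenmeyerPanova2017, Prop. 5 ("completely analogously to Prop. 2")] -/
theorem mem_orbitClosure_powFormLex_of_hasPowTraceRepr {n m : ℕ} {h : MvPolynomial (MatIdx m) ℂ}
    (hrep : HasPowTraceRepr ℂ h n m) : h ∈ orbitClosure (powFormLex ℂ m n) := by
  classical
  obtain ⟨A, hA1, hAtr⟩ := hrep
  set M : Matrix (MatIdx m) (MatIdx m) ℂ :=
    Matrix.of fun v w => coeff (Finsupp.single v 1) (A (ofLex w).1 (ofLex w).2) with hM
  refine endOrbit_subset_orbitClosure_holds (powFormLex ℂ m n) ⟨M, ?_⟩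
  set ψ : MvPolynomial (Fin m × Fin m) ℂ →ₐ[ℂ] MvPolynomial (MatIdx m) ℂ :=
    (linSubst (MatIdx m) ℂ M).comp (rename toLex) with hψ
  have hψX : ψ.mapMatrix (Matrix.mvPolynomialX (Fin m) (Fin m) ℂ) = A := by
    refine Matrix.ext fun a b => ?_
    rw [AlgHom.mapMatrix_apply, Matrix.map_apply, Matrix.mvPolynomialX_apply, hψ, AlgHom.comp_apply,
      rename_X, linSubst_X, eq_sum_coeff_smul_X (hA1 a b)]
    refine Finset.sum_congr rfl fun v _ => ?_
    rw [hM, Matrix.of_apply]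
    rfl
  calc linSubst (MatIdx m) ℂ M (powFormLex ℂ m n)
      = ψ (powTrace ℂ m n) := rfl
    _ = (A ^ n).trace := by rw [powTrace, algHom_trace_pow, hψX]
    _ = h := hAtr

/-- **GIP Cor. 6 / Thm. 8 for any target**: if `h = tr(A^n)` at matrix size `m` then every `λ`
(at most `m²` parts) occurring in `ℂ[\overline{GL_{m²} · h}]` (degree-`n` orbit coordinate ring)
occurs in `ℂ[\overline{GL_{m²} · Pow^n_m}]` (Schur's lemma along the restriction,
`hasHighestWeight_orbitCoordRep_of_mem_orbitClosure`), hence has `sm(λ, m) > 0` (`t_λ ≤ sm(λ, m)`,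
`smPos_of_hasHighestWeight_powTraceFormLex`). [cite: GesmundoIkenmeyerPanova2017, Cor. 6, Thm. 8 and Cor. 9] -/
theorem smPos_of_hasPowTraceRepr {n m D : ℕ} {h : MvPolynomial (MatIdx m) ℂ}
    (hrep : HasPowTraceRepr ℂ h n m) (lam : Nat.Partition D) (hlam : lam.parts.card ≤ m * m)
    (hocc : HasHighestWeight (orbitCoordRep h n) (partitionWeightLex m lam)) : SmPos m lam :=
  smPos_of_hasHighestWeight_powTraceFormLex lam hlam
    (Literature.Computability.Complexity.hasHighestWeight_orbitCoordRep_of_mem_orbitClosure (m := n)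
      (mem_orbitClosure_powFormLex_of_hasPowTraceRepr hrep) hocc)

/-- **GIP Cor. 9 for any target (the universal obstruction principle).** For a form `h` on
`V = ℂ^{m²}` admitting some power-trace representation in degree `n ≥ 1` (so that
`pc(h) = powTraceComplexity ℂ h n` is attained, `Nat.sInf_mem`, and pads to every larger size,
`HasPowTraceRepr.of_le`), an orbit occurrence obstruction at matrix size `m` — `λ` occurring in
`ℂ[\overline{GL_{m²} · h}]` with `sm(λ, m) = 0` — certifies `pc(h) > m`.
[cite: GesmundoIkenmeyerPanova2017, Cor. 9 (with Prop. 5, Cor. 6, Thm. 8)] -/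
theorem lt_powTraceComplexity_of_not_smPos {n m D : ℕ} (hn : 0 < n)
    {h : MvPolynomial (MatIdx m) ℂ} (hex : ∃ N₀, HasPowTraceRepr ℂ h n N₀)
    (lam : Nat.Partition D) (hlam : lam.parts.card ≤ m * m)
    (hocc : HasHighestWeight (orbitCoordRep h n) (partitionWeightLex m lam))
    (hsm : ¬ SmPos m lam) : m < powTraceComplexity ℂ h n := by
  by_contra hlt
  rw [not_lt] at hlt
  have hmem : HasPowTraceRepr ℂ h n (powTraceComplexity ℂ h n) :=
    Nat.sInf_mem (s := {m' | HasPowTraceRepr ℂ h n m'}) hex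
  exact hsm (smPos_of_hasPowTraceRepr (HasPowTraceRepr.of_le hn hlt hmem) lam hlam hocc)

/-- **The whole barrier, target-universal (summary).** For ANY target form `h` of degree `n ≥ 3`
on `V = ℂ^{m²}` with variables in `A` and some power-trace representation, an orbit occurrence
obstruction `λ` at matrix size `m` certifies `pc(h) > m` but exists only for
`m < ℓ(|A|) = max{⌈√|A|⌉ + 2, 12}`: orbit occurrence obstructions in the matrix-powering model
never certify more than `pc(h) ≥ max{⌈√|A|⌉ + 2, 12}`, whatever the target.
[cite: GesmundoIkenmeyerPanova2017, Cor. 9 and Thm. 10] -/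
theorem orbitOccurrenceObstruction_reach {n m d : ℕ} (hn : 3 ≤ n)
    {h : MvPolynomial (MatIdx m) ℂ} (hh : h.IsHomogeneous n) {A : Finset (MatIdx m)}
    (hA : ↑h.vars ⊆ (A : Set (MatIdx m))) (hex : ∃ N₀, HasPowTraceRepr ℂ h n N₀)
    (lam : Nat.Partition (d * n)) (hlam : lam.parts.card ≤ m * m)
    (hocc : HasHighestWeight (orbitCoordRep h n) (partitionWeightLex m lam))
    (hsm : ¬ SmPos m lam) : m < powTraceComplexity ℂ h n ∧ m < gipEll A.card :=
  ⟨lt_powTraceComplexity_of_not_smPos (by omega) hex lam hlam hocc hsm,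
    lt_gipEll_of_not_smPos hn hh hA lam hlam hocc hsm⟩

end Literature.Barriers.ValiantsHypothesis

end
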